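import Literature.Probability.LatticeModels.LatticeGreenReturnSeries
import Mathlib.Analysis.SpecialFunctions.Integrals.Basic
import Mathlib.Analysis.SpecialFunctions.Gaussian.GaussianIntegral
import Mathlib.Data.Nat.Choose.Vandermonde
import Mathlib.Data.Nat.Choose.Central
import Mathlib.Analysis.Real.Pi.Bounds
import HarnessLib

/-!
# The lattice Green function of `ℤ⁴` at the origin: `0.3086 ≤ R(4) ≤ 0.3104 < 5/16`, kernel-checked
# (Salmhofer–Seiler, CMP 139 (1991), Prop. 4.2 (4) and (A.60), p. 430: "`R(4) ≤ 0.3100`")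

Topic `Probability/LatticeModels`; the certificate announced in `LatticeGreenReturnSeries.lean`.
Salmhofer–Seiler's chiral-symmetry-breaking bound for `U(1)`/`U(2)` lattice gauge theory at `β = 0`
in `ν = 4` ((A.60), p. 430, formalised CONDITIONALLY in
`ComplexSpinChiralLROMonotone.u1∕u2_chiralLRO_of_latticeGreen_four_lt`) uses one computer-assisted
number, the infrared constant `R(4) = latticeGreen 0 = ∫_{[-π,π]⁴} d⁴k/((2π)⁴ Σ_μ(1 - cos k_μ))`
("`R(4) ≤ 0.3100`", obtained in print by majorising the integrand of (A.7) by a piecewise linear map).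
Here that number is certified by the Lean kernel:

* `intervalIntegral_cos_pow_eq` — the moments `∫_{-π}^{π} cos^m = 2π κ(m)`, `κ(2b) = binom(2b,b)/4^b`,
  `κ(2b+1) = 0` (Wallis' recursion, Mathlib `integral_cos_pow`), with `κ = cosMomentQ` a computable
  rational recursion;
* `sum_choose_mul_cosMomentQ` — the two-dimensional identity
  `Σ_a binom(i,a) κ(a) κ(i-a) = 2^i κ(i)²` (`= binom(2b,b)²/4^b` for `i = 2b`: the number of closed
  `2b`-step walks on `ℤ²` is `binom(2b,b)²`; Vandermonde, Mathlib `Nat.sum_range_choose_sq`);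
* `prob_four_eq_probFourQ`, `sum_range_prob_four_eq` — **the return probabilities of the simple random
  walk on `ℤ⁴` in closed form**, `P(Sₙ = 0) = 4⁻ⁿ Σ_i binom(n,i) k₂(i) k₂(n-i)`, `k₂(i) = 2^i κ(i)²`
  (Fourier formula `SRW.prob_eq_integral`, the binomial theorem three times, Fubini over the four
  coordinates), as the cast of the computable rational `probFourQ n`; for `n = 2m` this is
  `a_m/8^{2m}` with Guttmann's `a_m = binom(2m,m) Σ_k binom(m,k)² binom(2k,k) binom(2m-2k,m-k)`
  (J. Phys. A 43 (2010) 305205, §2.2; one of Almkvist's sixteen binomial-sum forms — the equality of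
  the two finite sums is checked numerically for `m ≤ 34`, not formalised);
* `srwHeatKernel_zero_le_sharp`, `srwHeatKernel_zero_le_of_le` — a sharpening of Lemma A.4 (A.22)
  adequate for numerics: `r(u) ≤ √(π/(κ₀u))/(2π) + ((π-1)/π)e^{-4u/9}` (`κ₀ = 43/96`, from
  `1 - cos k ≥ κ₀k²` on `[-1,1]`, Mathlib `Real.cos_bound`, the Gaussian integral, and `cos 1 ≤ 5/9`
  outside) and `r(u) ≤ 0.43 u^{-1/2}` for `u ≥ 21` (the printed `(1+2u)^{-1/2}` is asymptotically off
  by the factor `√π ≈ 1.77`); `integral_Ioi_srwHeatKernel_zero_pow_four_le`: `∫_{21}^∞ r⁴ ≤ 0.43⁴/21`;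
* `probFourPartialQ_84_le`, `le_probFourPartialQ_84` — `1.2346135 ≤ Σ_{n<84} P(Sₙ = 0) ≤ 1.2346136`
  by `decide +kernel` (exact rational arithmetic; seconds of kernel time);
* `four_mul_latticeGreen_four_zero_le`, `le_four_mul_latticeGreen_four_zero`,
  **`latticeGreen_four_zero_lt : latticeGreen (0 : Site 4) < 5/16`**,
  `latticeGreen_four_zero_mem_Icc : 0.3086 ≤ latticeGreen 0 ≤ 0.3104` and `SRW.green4_mem_Icc`
  (`1.2345 ≤ Σₙ P(Sₙ = 0) ≤ 1.2413`), from `LatticeGreenReturnSeries.sum_range_prob_zero_mem_Icc`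
  with `K = 84` (tail `4∫_{21}^∞ r⁴ + r(21)⁴ ≤ 0.43⁴(4/21 + 1/441)`).

The printed value `R(4) ≤ 0.3100` (true value `0.30987…`) is thus confirmed to `±0.001`; a
consumer in the Salmhofer–Seiler series turns the conditional (A.60) corollaries into theorems.
Honest framing: a statement about the simple random walk on `ℤ⁴` / the massless lattice propagator;
by itself it says nothing about gauge theories.

## References

* M. Salmhofer, E. Seiler, Commun. Math. Phys. 139 (1991) 395–432: Prop. 4.2 (4) (p. 418), Appendix
  (A.7), Lemma A.4 (A.22)–(A.23), (A.60) and the table of `R(ν)` (p. 430). [SalmhoferSeiler1991]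
* A. J. Guttmann, *Lattice Green's functions in all dimensions*, J. Phys. A 43 (2010) 305205,
  §2.2 (the `4d` hypercubic lattice: `a_n = binom(2n,n) Σ_k binom(n,k)² binom(2k,k) binom(2n-2k,n-k)`,
  the integral `∫₀^∞ e^{-t} I₀(zt/4)⁴ dt`). [Guttmann2010]
* G. F. Lawler, V. Limic, *Random Walk: A Modern Introduction*, CUP 2010, §4.3. [LawlerLimic2010]
-/

noncomputable section

open MeasureTheory Set Filter Finset Real
open scoped Topology BigOperators Nat

namespace Literature.Probability.LatticeModels

/-! ### Computable rational data -/

/-- The normalised moments of the cosine, `κ(m) = (2π)⁻¹ ∫_{-π}^{π} cos^m k dk`, as the computable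
rational recursion `κ(0) = 1`, `κ(1) = 0`, `κ(m+2) = κ(m)(m+1)/(m+2)` (Wallis; `κ(2b) = binom(2b,b)/4^b`
is the probability that the simple random walk on `ℤ` is at the origin at time `2b`).
[cite: SalmhoferSeiler1991, Appendix (A.24) with Lemma A.4] -/
def cosMomentQ : ℕ → ℚ
  | 0 => 1
  | 1 => 0
  | (m + 2) => cosMomentQ m * ((m + 1 : ℕ) : ℚ) / ((m + 2 : ℕ) : ℚ)

/-- The two-coordinate moment `k₂(i) = (2π)⁻² ∫∫ (cos θ₁ + cos θ₂)^i = 2^i κ(i)²` (for `i = 2b` this is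
`binom(2b,b)²/4^b`, the return probability of the simple random walk on `ℤ²` times `4^b`; see
`sum_choose_mul_cosMomentQ`). [folklore] -/
def twoCoordMomentQ (i : ℕ) : ℚ := (2 : ℚ) ^ i * cosMomentQ i * cosMomentQ i

/-- Binomial coefficients through factorials (kernel-evaluable: `Nat.factorial` is structurally
recursive, `Nat.choose` is not usable by the kernel at this size). [folklore] -/
def binomQ (n a : ℕ) : ℚ := ((n ! : ℕ) : ℚ) / ((a ! * (n - a) ! : ℕ) : ℚ)

/-- Structural partial sums `Σ_{i<n} f i` (kernel-evaluable stand-in for `Finset.sum (range n)`).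
[folklore] -/
def sumBelow (f : ℕ → ℚ) : ℕ → ℚ
  | 0 => 0
  | (n + 1) => sumBelow f n + f n

/-- **The return probability of the simple random walk on `ℤ⁴` as a computable rational**:
`probFourQ n = 4⁻ⁿ Σ_{i ≤ n} binom(n,i) k₂(i) k₂(n-i)` (`= P(Sₙ = 0)`, `prob_four_eq_probFourQ`; for
`n = 2m` this is `64^{-m} Σ_b binom(2m,2b) binom(2b,b)² binom(2m-2b,m-b)²`, for odd `n` it is `0`;
Guttmann, J. Phys. A 43 (2010) 305205, §2.2, prints the equivalent
`64^{-m} binom(2m,m) Σ_k binom(m,k)² binom(2k,k) binom(2m-2k,m-k)`). [cite: Guttmann2010, §2.2] -/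
def probFourQ (n : ℕ) : ℚ :=
  sumBelow (fun i => binomQ n i * twoCoordMomentQ i * twoCoordMomentQ (n - i)) (n + 1) / (4 : ℚ) ^ n

/-- Partial sums `Σ_{n<K} P(Sₙ = 0)` on `ℤ⁴` as a computable rational (partial sums of the lattice
Green function / return generating function at `z = 1`). [cite: Guttmann2010, §2.2] -/
def probFourPartialQ (K : ℕ) : ℚ := sumBelow probFourQ K

/-- `sumBelow f n = Σ_{i ∈ range n} f i`. [folklore] -/
private theorem sumBelow_eq_sum_range (f : ℕ → ℚ) : ∀ n, sumBelow f n = ∑ i ∈ Finset.range n, f i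
  | 0 => by simp [sumBelow]
  | (n + 1) => by rw [sumBelow, sumBelow_eq_sum_range f n, Finset.sum_range_succ]

/-- `binomQ n a = binom(n,a)` for `a ≤ n`. [folklore] -/
private theorem binomQ_eq_choose {n a : ℕ} (h : a ≤ n) : binomQ n a = (n.choose a : ℚ) := by
  unfold binomQ
  have hfac : ((a ! * (n - a) ! : ℕ) : ℚ) ≠ 0 := by positivity
  rw [div_eq_iff hfac]
  have := Nat.choose_mul_factorial_mul_factorial h
  rw [← this]
  push_cast
  ring

/-! ### The kernel evaluation -/

/-- `Σ_{n<84} P(Sₙ = 0) ≤ 1.2346136` on `ℤ⁴` (exact rational evaluation by the kernel).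
[cite: SalmhoferSeiler1991, p. 430 (numerical evaluation of `R(4)`)] -/
theorem probFourPartialQ_84_le : probFourPartialQ 84 ≤ 12346136 / 10000000 := by
  decide +kernel

/-- `1.2346135 ≤ Σ_{n<84} P(Sₙ = 0)` on `ℤ⁴` (exact rational evaluation by the kernel).
[cite: SalmhoferSeiler1991, p. 430 (numerical evaluation of `R(4)`)] -/
theorem le_probFourPartialQ_84 : 12346135 / 10000000 ≤ probFourPartialQ 84 := by
  decide +kernel

/-! ### The cosine moments: Wallis' recursion -/

/-- **`∫_{-π}^{π} cos^m k dk = 2π κ(m)`** (`integral_cos_pow`: the boundary terms vanish since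
`sin(±π) = 0`). [cite: SalmhoferSeiler1991, Appendix (A.24)] -/
theorem intervalIntegral_cos_pow_eq :
    ∀ m : ℕ, ∫ k in (-π)..π, Real.cos k ^ m = 2 * π * (cosMomentQ m : ℝ)
  | 0 => by simp [cosMomentQ]; ring
  | 1 => by simp [cosMomentQ]
  | (m + 2) => by
      rw [integral_cos_pow, intervalIntegral_cos_pow_eq m, cosMomentQ]
      simp only [Real.sin_pi, Real.sin_neg, mul_zero, neg_zero, sub_self, zero_div, zero_add]
      push_cast
      field_simp

/-- `κ(2b) = binom(2b,b)/4^b`. [folklore] -/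
private theorem cosMomentQ_two_mul : ∀ b : ℕ, cosMomentQ (2 * b) = (Nat.centralBinom b : ℚ) / 4 ^ b
  | 0 => by simp [cosMomentQ]
  | (b + 1) => by
      have hrec : cosMomentQ (2 * (b + 1)) = cosMomentQ (2 * b) * ((2 * b + 1 : ℕ) : ℚ) /
          ((2 * b + 2 : ℕ) : ℚ) := by
        rw [show 2 * (b + 1) = 2 * b + 2 by ring]
        rfl
      rw [hrec, cosMomentQ_two_mul b]
      have h := Nat.succ_mul_centralBinom_succ b
      have h' : ((b + 1 : ℕ) : ℚ) * (Nat.centralBinom (b + 1) : ℚ) =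
          2 * (2 * b + 1) * (Nat.centralBinom b : ℚ) := by exact_mod_cast h
      push_cast at h' ⊢
      have hb : ((b : ℚ) + 1) ≠ 0 := by positivity
      have hC : (Nat.centralBinom (b + 1) : ℚ) = 2 * (2 * b + 1) * Nat.centralBinom b / (b + 1) := by
        rw [eq_div_iff hb]
        linear_combination h'
      rw [hC]
      field_simp
      ring

/-- `κ(2b+1) = 0`. [folklore] -/
private theorem cosMomentQ_two_mul_add_one : ∀ b : ℕ, cosMomentQ (2 * b + 1) = 0
  | 0 => by simp [cosMomentQ]
  | (b + 1) => by
      have hrec : cosMomentQ (2 * (b + 1) + 1) = cosMomentQ (2 * b + 1) * ((2 * b + 1 + 1 : ℕ) : ℚ) /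
          ((2 * b + 1 + 2 : ℕ) : ℚ) := by
        rw [show 2 * (b + 1) + 1 = 2 * b + 1 + 2 by ring]
        rfl
      rw [hrec, cosMomentQ_two_mul_add_one b, zero_mul, zero_div]

/-- `κ(m) = 0` for odd `m`. [folklore] -/
private theorem cosMomentQ_eq_zero_of_odd {m : ℕ} (hm : Odd m) : cosMomentQ m = 0 := by
  obtain ⟨b, rfl⟩ := hm
  exact cosMomentQ_two_mul_add_one b

/-! ### The two-coordinate moments: Vandermonde -/

/-- A sum over `range (2β+1)` of a function vanishing at odd arguments is the sum over the even
arguments `2α`, `α ≤ β`. [folklore] -/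
private theorem sum_range_eq_sum_range_even (f : ℕ → ℚ) (hf : ∀ a, Odd a → f a = 0) :
    ∀ β : ℕ, ∑ a ∈ Finset.range (2 * β + 1), f a = ∑ α ∈ Finset.range (β + 1), f (2 * α)
  | 0 => by simp
  | (β + 1) => by
      rw [show 2 * (β + 1) + 1 = 2 * β + 1 + 1 + 1 by ring, Finset.sum_range_succ,
        Finset.sum_range_succ, sum_range_eq_sum_range_even f hf β, Finset.sum_range_succ (n := β + 1),
        hf (2 * β + 1) ⟨β, rfl⟩, add_zero, show 2 * β + 1 + 1 = 2 * (β + 1) by ring]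

/-- The binomial identity behind the two-dimensional return count:
`binom(2β,2α) binom(2α,α) binom(2β-2α,β-α) = binom(2β,β) binom(β,α)²` (`α ≤ β`; both sides are
`(2β)!/(α!²(β-α)!²)`). [folklore] -/
private theorem choose_two_mul_mul_centralBinom_mul {α β : ℕ} (h : α ≤ β) :
    (2 * β).choose (2 * α) * (2 * α).choose α * ((2 * β - 2 * α).choose (β - α)) =
      (2 * β).choose β * (β.choose α) ^ 2 := by
  have h1 := Nat.choose_mul (n := 2 * β) (k := 2 * α) (s := α) (by omega)
  rw [show 2 * α - α = α by omega] at h1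
  have h2 := Nat.choose_mul (n := 2 * β - α) (k := β) (s := α) h
  rw [show 2 * β - α - α = 2 * β - 2 * α by omega] at h2
  have h3 := Nat.choose_mul (n := 2 * β) (k := β) (s := α) h
  have h4 : (2 * β - α).choose (β - α) = (2 * β - α).choose β := by
    have := Nat.choose_symm (n := 2 * β - α) (k := β) (by omega)
    rwa [show 2 * β - α - β = β - α by omega] at this
  rw [h4] at h3
  calc (2 * β).choose (2 * α) * (2 * α).choose α * ((2 * β - 2 * α).choose (β - α))
      = (2 * β).choose α * ((2 * β - α).choose α * (2 * β - 2 * α).choose (β - α)) := by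
        rw [h1]; ring
    _ = (2 * β).choose α * ((2 * β - α).choose β * β.choose α) := by rw [h2]
    _ = (2 * β).choose β * β.choose α * β.choose α := by rw [h3]; ring
    _ = (2 * β).choose β * (β.choose α) ^ 2 := by ring

/-- **The two-dimensional identity** `Σ_a binom(i,a) κ(a) κ(i-a) = 2^i κ(i)² = k₂(i)`: the moments of
`cos θ₁ + cos θ₂` are those of `2 cos θ₁' cos θ₂'` (for `i = 2b`, `binom(2b,b)²/4^b`: the classical
count `a_{2b} = binom(2b,b)²` of closed `2b`-step walks on the square lattice, Guttmann 2010 §1 (square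
lattice); Vandermonde `Σ_α binom(β,α)² = binom(2β,β)`). [cite: Guttmann2010, §1 (square lattice: `a_{2n} = binom(2n,n)²`)] -/
theorem sum_choose_mul_cosMomentQ (i : ℕ) :
    ∑ a ∈ Finset.range (i + 1), (i.choose a : ℚ) * cosMomentQ a * cosMomentQ (i - a) =
      twoCoordMomentQ i := by
  unfold twoCoordMomentQ
  obtain ⟨β, rfl | rfl⟩ := Nat.even_or_odd' i
  · -- even `i = 2β`
    set f : ℕ → ℚ := fun a => ((2 * β).choose a : ℚ) * cosMomentQ a * cosMomentQ (2 * β - a) with hf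
    have hodd : ∀ a, Odd a → f a = 0 := fun a ha => by
      simp only [hf, cosMomentQ_eq_zero_of_odd ha, mul_zero, zero_mul]
    have hsum := sum_range_eq_sum_range_even f hodd β
    simp only [hf] at hsum
    rw [hsum]
    have hterm : ∀ α ∈ Finset.range (β + 1),
        ((2 * β).choose (2 * α) : ℚ) * cosMomentQ (2 * α) * cosMomentQ (2 * β - 2 * α) =
          ((2 * β).choose β : ℚ) * (β.choose α : ℚ) ^ 2 / 4 ^ β := by
      intro α hα
      have hαβ : α ≤ β := Nat.lt_succ_iff.1 (Finset.mem_range.1 hα)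
      rw [show 2 * β - 2 * α = 2 * (β - α) by omega, cosMomentQ_two_mul, cosMomentQ_two_mul]
      have hid := choose_two_mul_mul_centralBinom_mul hαβ
      have hid' : ((2 * β).choose (2 * α) : ℚ) * ((2 * α).choose α : ℚ) *
          ((2 * β - 2 * α).choose (β - α) : ℚ) = ((2 * β).choose β : ℚ) * (β.choose α : ℚ) ^ 2 := by
        exact_mod_cast hid
      rw [Nat.centralBinom_eq_two_mul_choose, Nat.centralBinom_eq_two_mul_choose,
        show 2 * (β - α) = 2 * β - 2 * α by omega]
      have h4 : (4 : ℚ) ^ β = 4 ^ α * 4 ^ (β - α) := by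
        rw [← pow_add, Nat.add_sub_cancel' hαβ]
      rw [h4]
      field_simp
      linear_combination hid'
    rw [Finset.sum_congr rfl hterm, ← Finset.sum_div, ← Finset.mul_sum]
    have hV : ∑ α ∈ Finset.range (β + 1), (β.choose α : ℚ) ^ 2 = ((2 * β).choose β : ℚ) := by
      exact_mod_cast Nat.sum_range_choose_sq β
    rw [hV, cosMomentQ_two_mul, Nat.centralBinom_eq_two_mul_choose]
    have h4 : (4 : ℚ) ^ β = (2 : ℚ) ^ (2 * β) := by rw [pow_mul]; norm_num
    rw [h4]
    field_simp
  · -- odd `i = 2β + 1`: every term vanishes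
    rw [cosMomentQ_two_mul_add_one, mul_zero]
    refine Finset.sum_eq_zero fun a ha => ?_
    have haβ : a ≤ 2 * β + 1 := Nat.lt_succ_iff.1 (Finset.mem_range.1 ha)
    rcases Nat.even_or_odd a with ⟨r, hr⟩ | hodd
    · have hodd' : Odd (2 * β + 1 - a) := ⟨β - r, by omega⟩
      rw [cosMomentQ_eq_zero_of_odd hodd', mul_zero]
    · rw [cosMomentQ_eq_zero_of_odd hodd, mul_zero, zero_mul]

/-! ### The return probabilities on `ℤ⁴` in closed form -/

/-- The moments of a monomial in the four cosines factor over the coordinates: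
`∫_{[-π,π]⁴} Πⱼ cos(θⱼ)^{mⱼ} dθ = Πⱼ 2π κ(mⱼ)`. [folklore] -/
private theorem setIntegral_prod_cos_pow (m : Fin 4 → ℕ) :
    ∫ θ in brillouin 4, ∏ j, Real.cos (θ j) ^ (m j) = ∏ j, (2 * π * (cosMomentQ (m j) : ℝ)) := by
  rw [volume_restrict_brillouin 4,
    integral_fintype_prod_eq_prod (f := fun j (k : ℝ) => Real.cos k ^ (m j))]
  refine Finset.prod_congr rfl fun j _ => ?_
  have hle : (-π : ℝ) ≤ π := by linarith [Real.pi_pos]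
  rw [integral_Icc_eq_integral_Ioc, ← intervalIntegral.integral_of_le hle, intervalIntegral_cos_pow_eq]

/-- The binomial theorem three times: `(Σⱼ cⱼ)^n = ((c₀ + c₁) + (c₂ + c₃))^n` expanded into monomials
`c₀^a c₁^{i-a} c₂^e c₃^{n-i-e}`. [folklore] -/
private theorem sum_cos_pow_eq_sum (θ : Fin 4 → ℝ) (n : ℕ) :
    (∑ j, Real.cos (θ j)) ^ n =
      ∑ i ∈ Finset.range (n + 1), ∑ a ∈ Finset.range (i + 1), ∑ e ∈ Finset.range (n - i + 1),
        ((n.choose i * (i.choose a * (n - i).choose e) : ℕ) : ℝ) *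
          ∏ j, Real.cos (θ j) ^ ((![a, i - a, e, n - i - e] : Fin 4 → ℕ) j) := by
  have hsum : ∑ j, Real.cos (θ j) = (Real.cos (θ 0) + Real.cos (θ 1)) + (Real.cos (θ 2) + Real.cos (θ 3)) := by
    simp only [Fin.sum_univ_four]
    ring
  rw [hsum, add_pow]
  refine Finset.sum_congr rfl fun i _ => ?_
  rw [add_pow (Real.cos (θ 0)), add_pow (Real.cos (θ 2)), Finset.sum_mul_sum, Finset.sum_mul]
  refine Finset.sum_congr rfl fun a _ => ?_
  rw [Finset.sum_mul]
  refine Finset.sum_congr rfl fun e _ => ?_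
  simp only [Fin.prod_univ_four, Matrix.cons_val_zero, Matrix.cons_val_one, Matrix.cons_val,
    Nat.cast_mul]
  ring

/-- `∫_{[-π,π]⁴} (Σⱼ cos θⱼ)^n dθ = (2π)⁴ Σ_i Σ_a Σ_e binom(n,i) binom(i,a) binom(n-i,e) κ(a)κ(i-a)κ(e)κ(n-i-e)`.
[folklore] -/
private theorem setIntegral_sum_cos_pow (n : ℕ) :
    ∫ θ in brillouin 4, (∑ j, Real.cos (θ j)) ^ n =
      (2 * π) ^ 4 * ∑ i ∈ Finset.range (n + 1), ∑ a ∈ Finset.range (i + 1),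
        ∑ e ∈ Finset.range (n - i + 1),
          ((n.choose i * (i.choose a * (n - i).choose e) : ℕ) : ℝ) *
            ((cosMomentQ a : ℝ) * cosMomentQ (i - a) * (cosMomentQ e * cosMomentQ (n - i - e))) := by
  have hK := isCompact_brillouin 4
  -- every monomial term is continuous, hence integrable on the compact Brillouin zone
  have hterm : ∀ (c : ℝ) (m : Fin 4 → ℕ),
      Integrable (fun θ : Fin 4 → ℝ => c * ∏ j, Real.cos (θ j) ^ (m j))
        (volume.restrict (brillouin 4)) := fun c m =>
    (by fun_prop : Continuous fun θ : Fin 4 → ℝ => c * ∏ j, Real.cos (θ j) ^ (m j))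
      |>.continuousOn.integrableOn_compact hK
  simp_rw [sum_cos_pow_eq_sum]
  rw [integral_finsetSum _ fun i _ => integrable_finsetSum _ fun a _ =>
    integrable_finsetSum _ fun e _ => hterm _ _]
  rw [Finset.mul_sum]
  refine Finset.sum_congr rfl fun i _ => ?_
  rw [integral_finsetSum _ fun a _ => integrable_finsetSum _ fun e _ => hterm _ _, Finset.mul_sum]
  refine Finset.sum_congr rfl fun a _ => ?_
  rw [integral_finsetSum _ fun e _ => hterm _ _, Finset.mul_sum]
  refine Finset.sum_congr rfl fun e _ => ?_
  rw [integral_const_mul, setIntegral_prod_cos_pow]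
  simp only [Fin.prod_univ_four, Matrix.cons_val_zero, Matrix.cons_val_one, Matrix.cons_val]
  ring

/-- **The return probabilities of the simple random walk on `ℤ⁴` in closed form**:
`P(Sₙ = 0) = probFourQ n = 4⁻ⁿ Σ_i binom(n,i) k₂(i) k₂(n-i)` with `k₂(i) = 2^i κ(i)²`
(`κ(2b) = binom(2b,b)/4^b`, `κ(odd) = 0`); equivalently, the number of closed `2m`-step walks on `ℤ⁴`
is `Σ_b binom(2m,2b) binom(2b,b)² binom(2m-2b,m-b)²` (Guttmann 2010, §2.2, prints Almkvist's form
`binom(2m,m) Σ_k binom(m,k)² binom(2k,k) binom(2m-2k,m-k)` of the same integers).  (Fourier formula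
`SRW.prob_eq_integral`, the binomial theorem, Fubini over the four coordinates, Wallis, Vandermonde.)
[cite: Guttmann2010, §2.2] -/
theorem prob_four_eq_probFourQ (n : ℕ) : SRW.prob 4 n 0 = (probFourQ n : ℝ) := by
  rw [SRW.prob_eq_integral (by norm_num) n]
  have hpow : ∀ θ : Fin 4 → ℝ, (((4 : ℕ) : ℝ)⁻¹ * ∑ j, Real.cos (θ j)) ^ n =
      ((4 : ℝ) ^ n)⁻¹ * (∑ j, Real.cos (θ j)) ^ n := fun θ => by
    rw [mul_pow, Nat.cast_ofNat, inv_pow]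
  simp_rw [hpow]
  rw [integral_const_mul, setIntegral_sum_cos_pow]
  -- the rational side
  unfold probFourQ
  rw [sumBelow_eq_sum_range]
  have hQ : ∀ i ∈ Finset.range (n + 1),
      binomQ n i * twoCoordMomentQ i * twoCoordMomentQ (n - i) =
        (n.choose i : ℚ) * (∑ a ∈ Finset.range (i + 1), (i.choose a : ℚ) * cosMomentQ a * cosMomentQ (i - a)) *
          ∑ e ∈ Finset.range (n - i + 1), ((n - i).choose e : ℚ) * cosMomentQ e * cosMomentQ (n - i - e) := by
    intro i hi
    rw [binomQ_eq_choose (Nat.lt_succ_iff.1 (Finset.mem_range.1 hi)), sum_choose_mul_cosMomentQ,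
      sum_choose_mul_cosMomentQ]
  rw [Finset.sum_congr rfl hQ]
  push_cast
  have h2π : (2 * π : ℝ) ^ 4 ≠ 0 := by positivity
  have hS : (∑ i ∈ Finset.range (n + 1), ∑ a ∈ Finset.range (i + 1), ∑ e ∈ Finset.range (n - i + 1),
      ((n.choose i : ℝ) * ((i.choose a : ℝ) * ((n - i).choose e : ℝ))) *
        ((cosMomentQ a : ℝ) * cosMomentQ (i - a) * (cosMomentQ e * cosMomentQ (n - i - e)))) =
      ∑ i ∈ Finset.range (n + 1), ((n.choose i : ℝ) *
          ∑ a ∈ Finset.range (i + 1), (i.choose a : ℝ) * cosMomentQ a * cosMomentQ (i - a)) *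
        ∑ e ∈ Finset.range (n - i + 1), ((n - i).choose e : ℝ) * cosMomentQ e * cosMomentQ (n - i - e) := by
    refine Finset.sum_congr rfl fun i _ => ?_
    rw [mul_assoc, Finset.sum_mul_sum, Finset.mul_sum]
    refine Finset.sum_congr rfl fun a _ => ?_
    rw [Finset.mul_sum]
    refine Finset.sum_congr rfl fun e _ => ?_
    ring
  rw [hS]
  field_simp

/-- **`Σ_{n<K} P(Sₙ = 0) = probFourPartialQ K`** on `ℤ⁴`. [cite: Guttmann2010, §2.2] -/
theorem sum_range_prob_four_eq (K : ℕ) :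
    ∑ n ∈ Finset.range K, SRW.prob 4 n 0 = (probFourPartialQ K : ℝ) := by
  unfold probFourPartialQ
  rw [sumBelow_eq_sum_range]
  push_cast
  exact Finset.sum_congr rfl fun n _ => prob_four_eq_probFourQ n

/-! ### A sharpening of Lemma A.4 for numerics: `r(u) ≤ 0.43 u^{-1/2}` for `u ≥ 21` -/

/-- On `[-1, 1]`: `1 - cos k ≥ (43/96) k²` (Mathlib `Real.cos_bound`). [folklore] -/
private theorem mul_sq_le_one_sub_cos {k : ℝ} (hk : |k| ≤ 1) : 43 / 96 * k ^ 2 ≤ 1 - Real.cos k := by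
  have h := Real.cos_bound hk
  have h4 : |k| ^ 4 ≤ k ^ 2 := by
    have hk2 : k ^ 2 ≤ 1 := by nlinarith [abs_nonneg k, sq_abs k]
    calc |k| ^ 4 = k ^ 2 * k ^ 2 := by rw [← sq_abs k]; ring
      _ ≤ k ^ 2 * 1 := mul_le_mul_of_nonneg_left hk2 (sq_nonneg k)
      _ = k ^ 2 := mul_one _
  have h1 := (abs_le.1 h).2
  nlinarith

/-- On `1 ≤ |k| ≤ π`: `1 - cos k ≥ 4/9` (`cos` is decreasing on `[0, π]` and `cos 1 ≤ 5/9`). [folklore] -/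
private theorem le_one_sub_cos_of_one_le_abs {k : ℝ} (hk1 : 1 ≤ |k|) (hkπ : |k| ≤ π) :
    4 / 9 ≤ 1 - Real.cos k := by
  have h : Real.cos |k| ≤ Real.cos 1 := Real.cos_le_cos_of_nonneg_of_le_pi zero_le_one hkπ hk1
  rw [Real.cos_abs] at h
  linarith [Real.cos_one_le]

/-- **Lemma A.4 sharpened**: for `u > 0`,
`r(u) ≤ √(π/(κ₀u))/(2π) + ((π-1)/π) e^{-4u/9}`, `κ₀ = 43/96` — split `∫_{-π}^{π} e^{-u(1-cos k)} dk` at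
`|k| = 1`, use `1 - cos k ≥ κ₀k²` inside (Gaussian integral) and `1 - cos k ≥ 4/9` outside.  The printed
bound (A.22), `r(u) ≤ (1+2u)^{-1/2}`, has the right decay but is asymptotically larger by the factor
`√π`; the present one is within `6%` of `r(u) ∼ (2πu)^{-1/2}` for `u ≥ 20`. [cite: SalmhoferSeiler1991, Lemma A.4 (A.22), (A.24)] -/
theorem srwHeatKernel_zero_le_sharp {u : ℝ} (hu : 0 < u) :
    srwHeatKernel u 0 ≤
      Real.sqrt (π / (43 / 96 * u)) / (2 * π) + (π - 1) / π * Real.exp (-(4 / 9 * u)) := by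
  set E : ℝ → ℝ := fun k => Real.exp (-(u * (1 - Real.cos k))) with hE
  have hEc : Continuous E := by simp only [hE]; fun_prop
  have hEi : ∀ a b : ℝ, IntervalIntegrable E volume a b := fun a b => hEc.intervalIntegrable a b
  have hπ1 : (1 : ℝ) ≤ π := by linarith [Real.pi_gt_three]
  -- outer pieces
  have hout : ∀ k : ℝ, 1 ≤ |k| → |k| ≤ π → E k ≤ Real.exp (-(4 / 9 * u)) := by
    intro k hk1 hkπ
    simp only [hE]
    exact Real.exp_le_exp.2 (by nlinarith [le_one_sub_cos_of_one_le_abs hk1 hkπ])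
  have hright : ∫ k in (1 : ℝ)..π, E k ≤ (π - 1) * Real.exp (-(4 / 9 * u)) := by
    have h := intervalIntegral.integral_mono_on hπ1 (hEi 1 π) intervalIntegrable_const
      (fun k hk => hout k (by rw [abs_of_nonneg (by linarith [hk.1])]; exact hk.1)
        (by rw [abs_of_nonneg (by linarith [hk.1])]; exact hk.2))
    rwa [intervalIntegral.integral_const, smul_eq_mul] at h
  have hleft : ∫ k in (-π)..(-1 : ℝ), E k ≤ (π - 1) * Real.exp (-(4 / 9 * u)) := by
    have h := intervalIntegral.integral_mono_on (by linarith : (-π : ℝ) ≤ -1) (hEi (-π) (-1))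
      intervalIntegrable_const
      (fun k hk => hout k (by rw [abs_of_nonpos (by linarith [hk.2])]; linarith [hk.2])
        (by rw [abs_of_nonpos (by linarith [hk.2])]; linarith [hk.1]))
    rw [intervalIntegral.integral_const, smul_eq_mul] at h
    linarith
  -- the middle piece: a Gaussian
  have hκ : (0 : ℝ) < 43 / 96 * u := by positivity
  have hmid : ∫ k in (-1 : ℝ)..1, E k ≤ Real.sqrt (π / (43 / 96 * u)) := by
    have h1 : ∫ k in (-1 : ℝ)..1, E k ≤ ∫ k in (-1 : ℝ)..1, Real.exp (-(43 / 96 * u) * k ^ 2) := by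
      refine intervalIntegral.integral_mono_on (by norm_num) (hEi (-1) 1)
        ((by fun_prop : Continuous fun k : ℝ => Real.exp (-(43 / 96 * u) * k ^ 2)).intervalIntegrable
          _ _) fun k hk => ?_
      simp only [hE]
      refine Real.exp_le_exp.2 ?_
      have := mul_sq_le_one_sub_cos (abs_le.2 ⟨hk.1, hk.2⟩)
      nlinarith
    have h2 : ∫ k in (-1 : ℝ)..1, Real.exp (-(43 / 96 * u) * k ^ 2) ≤
        ∫ k, Real.exp (-(43 / 96 * u) * k ^ 2) := by
      rw [intervalIntegral.integral_of_le (by norm_num)]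
      exact setIntegral_le_integral (integrable_exp_neg_mul_sq hκ)
        (Eventually.of_forall fun k => (Real.exp_pos _).le)
    rw [integral_gaussian] at h2
    exact h1.trans h2
  -- assemble
  have hsplit : ∫ k in (-π)..π, E k =
      (∫ k in (-π)..(-1 : ℝ), E k) + ((∫ k in (-1 : ℝ)..1, E k) + ∫ k in (1 : ℝ)..π, E k) := by
    rw [intervalIntegral.integral_add_adjacent_intervals (hEi _ _) (hEi _ _),
      intervalIntegral.integral_add_adjacent_intervals (hEi _ _) (hEi _ _)]
  have htot : ∫ k in (-π)..π, E k ≤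
      Real.sqrt (π / (43 / 96 * u)) + 2 * ((π - 1) * Real.exp (-(4 / 9 * u))) := by
    rw [hsplit]; linarith
  rw [srwHeatKernel_zero_eq]
  have h2π : (0 : ℝ) < 2 * π := by positivity
  rw [div_le_iff₀ h2π]
  calc ∫ k in (-π)..π, Real.exp (-(u * (1 - Real.cos k))) = ∫ k in (-π)..π, E k := rfl
    _ ≤ Real.sqrt (π / (43 / 96 * u)) + 2 * ((π - 1) * Real.exp (-(4 / 9 * u))) := htot
    _ = (Real.sqrt (π / (43 / 96 * u)) / (2 * π) + (π - 1) / π * Real.exp (-(4 / 9 * u))) *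
          (2 * π) := by
        field_simp

/-- `e^{-u/3} √u ≤ e^{-7} √21` for `u ≥ 21` (`√(u/21) ≤ 1 + (u-21)/3 ≤ e^{(u-21)/3}`). [folklore] -/
private theorem exp_neg_mul_sqrt_le {u : ℝ} (hu : 21 ≤ u) :
    Real.exp (-(u / 3)) * Real.sqrt u ≤ Real.exp (-7) * Real.sqrt 21 := by
  set v : ℝ := (u - 21) / 3 with hv
  have hv0 : 0 ≤ v := by rw [hv]; linarith
  have h1 : Real.sqrt u ≤ Real.sqrt 21 * (1 + v) := by
    have h21 : Real.sqrt 21 * (1 + v) = Real.sqrt (21 * (1 + v) ^ 2) := by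
      rw [Real.sqrt_mul (by norm_num), Real.sqrt_sq (by linarith)]
    rw [h21]
    exact Real.sqrt_le_sqrt (by rw [hv]; nlinarith)
  have h2 : 1 + v ≤ Real.exp v := by linarith [Real.add_one_le_exp v]
  have h3 : Real.sqrt u ≤ Real.sqrt 21 * Real.exp v :=
    h1.trans (mul_le_mul_of_nonneg_left h2 (Real.sqrt_nonneg _))
  have h4 : Real.exp (-(u / 3)) * Real.exp v = Real.exp (-7) := by
    rw [← Real.exp_add]
    congr 1
    rw [hv]
    ring
  calc Real.exp (-(u / 3)) * Real.sqrt u ≤ Real.exp (-(u / 3)) * (Real.sqrt 21 * Real.exp v) :=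
        mul_le_mul_of_nonneg_left h3 (Real.exp_pos _).le
    _ = Real.exp (-(u / 3)) * Real.exp v * Real.sqrt 21 := by ring
    _ = Real.exp (-7) * Real.sqrt 21 := by rw [h4]

/-- `e^{-7} √21 ≤ 0.0042` (`e^{-1} < 0.3678794412`, `√21 < 4.583`). [folklore] -/
private theorem exp_neg_seven_mul_sqrt_le : Real.exp (-7) * Real.sqrt 21 ≤ 42 / 10000 := by
  have he : Real.exp (-7) = Real.exp (-1) ^ 7 := by
    rw [← Real.exp_nat_mul]; norm_num
  have he1 : Real.exp (-1) ^ 7 ≤ (0.3678794412 : ℝ) ^ 7 :=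
    pow_le_pow_left₀ (Real.exp_pos _).le Real.exp_neg_one_lt_d9.le 7
  have hs : Real.sqrt 21 ≤ 4.583 := by
    rw [Real.sqrt_le_left (by norm_num)]
    norm_num
  rw [he]
  calc Real.exp (-1) ^ 7 * Real.sqrt 21 ≤ (0.3678794412 : ℝ) ^ 7 * 4.583 :=
        mul_le_mul he1 hs (Real.sqrt_nonneg _) (by positivity)
    _ ≤ 42 / 10000 := by norm_num

/-- **`r(u) ≤ 0.43 u^{-1/2}` for `u ≥ 21`** (the form used by the certificate; from
`srwHeatKernel_zero_le_sharp` with `3.14 < π`, `(π-1)/π ≤ 1`, `e^{-4u/9} ≤ e^{-u/3} ≤ e^{-7}√21·u^{-1/2}`).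
The true constant is `(2π)^{-1/2} ≈ 0.399`. [cite: SalmhoferSeiler1991, Lemma A.4 (A.22)] -/
theorem srwHeatKernel_zero_le_of_le {u : ℝ} (hu : 21 ≤ u) :
    srwHeatKernel u 0 ≤ 43 / 100 / Real.sqrt u := by
  have hu0 : 0 < u := by linarith
  have hsu : 0 < Real.sqrt u := Real.sqrt_pos.2 hu0
  have h := srwHeatKernel_zero_le_sharp hu0
  -- the Gaussian term
  have hA : Real.sqrt (π / (43 / 96 * u)) / (2 * π) ≤ 4225 / 10000 / Real.sqrt u := by
    rw [div_le_div_iff₀ (by positivity) hsu]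
    have hmul : Real.sqrt (π / (43 / 96 * u)) * Real.sqrt u = Real.sqrt (π / (43 / 96)) := by
      rw [← Real.sqrt_mul (by positivity)]
      congr 1
      field_simp
    rw [hmul, Real.sqrt_le_left (by positivity)]
    nlinarith [Real.pi_gt_d2, Real.pi_pos]
  -- the exponentially small term
  have hB : (π - 1) / π * Real.exp (-(4 / 9 * u)) ≤ 42 / 10000 / Real.sqrt u := by
    have hfrac : (π - 1) / π ≤ 1 := by
      rw [div_le_one Real.pi_pos]
      linarith
    have hfrac0 : 0 ≤ (π - 1) / π := div_nonneg (by linarith [Real.pi_gt_three]) Real.pi_pos.le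
    have hexp : Real.exp (-(4 / 9 * u)) ≤ Real.exp (-(u / 3)) := Real.exp_le_exp.2 (by linarith)
    have hkey : Real.exp (-(u / 3)) ≤ 42 / 10000 / Real.sqrt u := by
      rw [le_div_iff₀ hsu]
      exact (exp_neg_mul_sqrt_le hu).trans exp_neg_seven_mul_sqrt_le
    calc (π - 1) / π * Real.exp (-(4 / 9 * u)) ≤ 1 * Real.exp (-(u / 3)) :=
          mul_le_mul hfrac hexp (Real.exp_pos _).le zero_le_one
      _ ≤ 42 / 10000 / Real.sqrt u := by rw [one_mul]; exact hkey
  calc srwHeatKernel u 0 ≤ _ := h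
    _ ≤ 4225 / 10000 / Real.sqrt u + 42 / 10000 / Real.sqrt u := add_le_add hA hB
    _ ≤ 43 / 100 / Real.sqrt u := by
        rw [← add_div]
        exact div_le_div_of_nonneg_right (by norm_num) hsu.le

/-- `r(u)⁴ ≤ 0.43⁴ u⁻²` for `u ≥ 21`. [cite: SalmhoferSeiler1991, Lemma A.4 (A.22)] -/
private theorem srwHeatKernel_zero_pow_four_le {u : ℝ} (hu : 21 ≤ u) :
    srwHeatKernel u 0 ^ 4 ≤ (43 / 100) ^ 4 * (u ^ 2)⁻¹ := by
  have hu0 : 0 < u := by linarith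
  have h := pow_le_pow_left₀ (srwHeatKernel_zero_nonneg u) (srwHeatKernel_zero_le_of_le hu) 4
  have hsq : Real.sqrt u ^ 4 = u ^ 2 := by
    rw [show (4 : ℕ) = 2 * 2 from rfl, pow_mul, Real.sq_sqrt hu0.le]
  rw [div_pow, hsq] at h
  rwa [div_eq_mul_inv] at h

/-- **The tail of (A.7) beyond `u = 21` in `ν = 4`**: `∫_{21}^∞ r(u)⁴ du ≤ 0.43⁴/21`.
[cite: SalmhoferSeiler1991, Appendix (A.7), Lemma A.4] -/
theorem integral_Ioi_srwHeatKernel_zero_pow_four_le :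
    ∫ u in Set.Ioi (21 : ℝ), srwHeatKernel u 0 ^ 4 ≤ (43 / 100) ^ 4 / 21 := by
  obtain ⟨hint, -⟩ := setIntegral_exp_mul_inv_dispersion_eq (d := 4) (by norm_num)
    (by norm_num : (0 : ℝ) ≤ 21)
  have hmaj : IntegrableOn (fun u : ℝ => (43 / 100 : ℝ) ^ 4 * u ^ (-2 : ℝ)) (Set.Ioi 21) :=
    (integrableOn_Ioi_rpow_of_lt (by norm_num) (by norm_num)).const_mul _
  have hval : ∫ u in Set.Ioi (21 : ℝ), (43 / 100 : ℝ) ^ 4 * u ^ (-2 : ℝ) = (43 / 100) ^ 4 / 21 := by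
    rw [integral_const_mul, integral_Ioi_rpow_of_lt (by norm_num) (by norm_num)]
    norm_num
  rw [← hval]
  refine setIntegral_mono_on hint hmaj measurableSet_Ioi fun u hu => ?_
  have hu' : (21 : ℝ) < u := hu
  have hu0 : 0 < u := by linarith
  have hrpow : u ^ (-2 : ℝ) = (u ^ 2)⁻¹ := by
    rw [Real.rpow_neg hu0.le, Real.rpow_two]
  rw [hrpow]
  exact srwHeatKernel_zero_pow_four_le hu'.le

/-! ### The certificate: `0.3086 ≤ R(4) ≤ 0.3104 < 5/16` -/

/-- **`4 R(4) ≤ 1.2413`**: `4·latticeGreen 0 ≤ Σ_{n<84} P(Sₙ=0) + 4∫_{21}^∞ r⁴ + r(21)⁴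
≤ 1.2346136 + 0.43⁴(4/21 + 1/441)`. [cite: SalmhoferSeiler1991, Prop. 4.2 (4) and p. 430 (`R(4) ≤ 0.3100`)] -/
theorem four_mul_latticeGreen_four_zero_le : 4 * latticeGreen (0 : Site 4) ≤ 12413 / 10000 := by
  have hIcc := (sum_range_prob_zero_mem_Icc (d := 4) (by norm_num) 84).1
  have h84 : ((84 : ℕ) : ℝ) / ((4 : ℕ) : ℝ) = 21 := by norm_num
  rw [h84, sum_range_prob_four_eq] at hIcc
  have hP : ((probFourPartialQ 84 : ℚ) : ℝ) ≤ 12346136 / 10000000 := by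
    have h := (Rat.cast_le (K := ℝ)).2 probFourPartialQ_84_le
    push_cast at h
    exact h
  have hT := integral_Ioi_srwHeatKernel_zero_pow_four_le
  have hr : srwHeatKernel 21 0 ^ 4 ≤ (43 / 100) ^ 4 * ((21 : ℝ) ^ 2)⁻¹ :=
    srwHeatKernel_zero_pow_four_le le_rfl
  push_cast at hIcc
  nlinarith

/-- **`1.2345 ≤ 4 R(4)`**: `Σ_{n<84} P(Sₙ=0) - r(21)⁴ ≤ 4·latticeGreen 0`. [cite: SalmhoferSeiler1991, p. 430 (`R(4) ≤ 0.3100`)] -/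
theorem le_four_mul_latticeGreen_four_zero : 12345 / 10000 ≤ 4 * latticeGreen (0 : Site 4) := by
  have hIcc := (sum_range_prob_zero_mem_Icc (d := 4) (by norm_num) 84).2
  have h84 : ((84 : ℕ) : ℝ) / ((4 : ℕ) : ℝ) = 21 := by norm_num
  rw [h84, sum_range_prob_four_eq] at hIcc
  have hP : (12346135 / 10000000 : ℝ) ≤ ((probFourPartialQ 84 : ℚ) : ℝ) := by
    have h := (Rat.cast_le (K := ℝ)).2 le_probFourPartialQ_84
    push_cast at h
    exact h
  have hr : srwHeatKernel 21 0 ^ 4 ≤ (43 / 100) ^ 4 * ((21 : ℝ) ^ 2)⁻¹ :=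
    srwHeatKernel_zero_pow_four_le le_rfl
  push_cast at hIcc
  nlinarith

/-- **The infrared constant of `ℤ⁴`: `R(4) = latticeGreen 0 < 5/16`** — the computer-assisted input
of Salmhofer–Seiler's (A.60) ("`S(4) ≤ 4R(4) - 3/4 < 1/2`", with the printed `R(4) ≤ 0.3100`), now a
kernel-checked theorem; it discharges the hypothesis of
`ComplexSpinChiralLROMonotone.u1∕u2_chiralLRO_of_latticeGreen_four_lt`.
[cite: SalmhoferSeiler1991, Prop. 4.2 (4), (A.60) and p. 430] -/
theorem latticeGreen_four_zero_lt : latticeGreen (0 : Site 4) < 5 / 16 := by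
  linarith [four_mul_latticeGreen_four_zero_le]

/-- **`0.3086 ≤ R(4) ≤ 0.3104`** (true value `0.30987…`; printed "`R(4) ≤ 0.3100`", p. 430).
[cite: SalmhoferSeiler1991, p. 430 (table of `R(ν)`)] -/
theorem latticeGreen_four_zero_mem_Icc :
    (3086 / 10000 : ℝ) ≤ latticeGreen (0 : Site 4) ∧ latticeGreen (0 : Site 4) ≤ 3104 / 10000 := by
  constructor <;>
    linarith [four_mul_latticeGreen_four_zero_le, le_four_mul_latticeGreen_four_zero]

/-- The same for the expected number of visits of the simple random walk on `ℤ⁴` to its starting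
point: `1.2345 ≤ SRW.green4 = Σₙ P(Sₙ = 0) ≤ 1.2413` (so the return probability `1 - 1/G` lies in
`[0.1899, 0.1944]`; Pólya's constant `0.1932…`). [cite: LawlerLimic2010, §4.3] -/
theorem SRW.green4_mem_Icc : (12345 / 10000 : ℝ) ≤ SRW.green4 ∧ SRW.green4 ≤ 12413 / 10000 := by
  rw [SRW.green4_eq_four_mul_latticeGreen]
  exact ⟨le_four_mul_latticeGreen_four_zero, four_mul_latticeGreen_four_zero_le⟩

end Literature.Probability.LatticeModels
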